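import Summits.ValiantsHypothesis.ValiantsHypothesis.Theorems.NewtonUnitEquationsTwoProductsRankOneThreeGenLawSliceExc
import HarnessLib

/-!
# Route NewtonUnitEquations — crux `TwoProducts` (stmt-ValiantsHypothesis-5906), line `relation_ladder`, rung R7b (rank one on THREE
# letters, ALL coefficient patterns `p•α = q•β + r•γ`) + rung R7c (TWO letters with torsion): the DILATED FREE LIFT — part 4/7 — finite SHIFT RANK (T5) and the planar instance with the `p`-dilated push-forward (T7)

(T5) `lam_add`, `hsd_choose`, `restProd_add`, `ind_add`, `corr_hsd`, `mainTerm_hsd`, `Fsl_hsd`, `Fsl_shift` over the landed `R6b.HSD` toolkit and `R7a.SIdx`; (T7) `RelData` (`p•α = q•β + r•γ`), dilation `dilE`/`nsmul_cancel`, `enumP`, the lift `GT`, injectivity from rank-one coincidences, lifted visible points.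

val-idea-8 g3 (ideator; lens decomp), 2026-08-28.  THE GENERAL THREE-LETTER RANK-ONE LAW `p•α = q•β + r•γ` (all `p, q ≥ 1`, `r ≥ 0`):
lift `α ↦ Y_b^q Y_c^r, β ↦ Y_b^p, γ ↦ Y_c^p` over the `p`-DILATED plane (`enumP : b ↦ β, c ↦ γ, i ↦ p•enum i`), fibres `k` with divisibility
guards `p ∣ x_b − qk`, `p ∣ x_c − rk`, letter count `B_k = k + (x_b−qk)/p + (x_c−rk)/p`, DOUBLE SLICING `(b₁, b₂) = (x_b, x_c)`, the coefficient
theorem with `Pfac · C(R + B_k − 1, B_k) · κ_k`, finite SHIFT RANK and val-lit-p3's `ShiftRank.pencilCount` BY NAME; large or absent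
coefficients/letters are permutation type (R3♯).  Instances: R6b (1;1,1), R6c (2;1,1), R7a (p = 1, `visible_bound_free`), R6d = val-lit-p3's
homogeneous shape (p = q + r, `visible_bound_hom`), and rung R7c = rank one on TWO letters with torsion `p•α = q•β` (`r = 0`, idle third letter).

PORT NOTE (val-lit-p3 g15, prover seat, helper mode `--supports stmt-ValiantsHypothesis-5906 --as helper`, no stub credit claimed; the author's
request val-width INBOX 12:15Z/12:19Z + desk RULING #279 (c)): part 4/7 of a VERBATIM Theorems-side port of val-idea-8 g3's sorry-free module
`Cruxes/TwoProducts/Lines/relation_ladder_R7b.lean` REV 2 (tree sha256 f9e10d1fedcbd387…; 1 890 lines; `lean check` rc 0, 0 sorries,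
0 warnings, axioms standard).  ALL mathematics and ALL proofs are val-idea-8 g3's.  Port changes only: (i) file split + import chain;
(ii) declarations re-declared verbatim from LANDED ports are referenced BY NAME instead — `R6b.sum_sgn`, `R6b.HSD` (+ six closure
lemmas), `R6b.hsd_binChar` (R6b port); `tab`, `sgn`, `toolBound_mono` (R6 port, parent namespace); `R7a.SIdx`, `R7a.card_SIdx`,
`R7a.msetT_apply_le`, `R7a.permType_of_rankOne_largeCoeff`, `R7a.permType_of_rankOne_absent` (R7a port); `rankOne_symm` =
`R6c.rankOneCoincidences_symm` (R6c); `wt_nsmul'` = `FormalLogLinearisation.wt_nsmul`; (iii) section variables α-renamed `I ↦ Ig`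
(QIdx datum), `D ↦ Dg` (RelData datum) — forced by the gate's textual statement index (`dedup.landed`), since the R6b / R7a ports own
same-text lemmas over `ThreeIdx` / `QIdx`; (iv) docstrings on API lemmas; (v) in part 7/7 the parameter-free `def RankOneThreeGenLaw : Prop`
and `def RankOneTwoLaw : Prop` are NOT declared (relocation rule) — the laws are stated by their LITERAL bodies as `rankOneThreeGenLaw_proof`
and `rankOneTwoLaw_proof`; `visible_bound_free` / `visible_bound_hom` keep their names and texts.  Namespace = the author's
(`…PermutationType.R7b`).  Nothing here closes the line's residual, the crux `TwoProducts` (5906) or `VP ≠ VNP`; no summit statement is proved.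

Honest scope (the author's): rank one on FOUR letters with general coefficients, relations on ≥ 5 letters, one-sided `p•α = Σ qᵢ βᵢ` (R8, memo
only) and coincidence rank ≥ 2 are NOT covered here.  Nothing here moves VP ≠ VNP; `TwoProducts` (5906) stays OPEN. [folklore]
-/

noncomputable section

-- Sub = Summit single-conjunct layout: the duplicated namespace component is mandated by the tree.
set_option linter.dupNamespace false
set_option linter.unusedSimpArgs false
set_option linter.deprecated false
set_option linter.unusedSectionVars false
set_option linter.unusedVariables false
set_option linter.unnecessarySeqFocus false

namespace Summit.ValiantsHypothesis.ValiantsHypothesis.Theorems.NewtonUnitEquations.TwoProducts.PermutationType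
namespace R7b
open scoped BigOperators
open MvPolynomial

variable {σ : Type*} [Fintype σ] [DecidableEq σ]

variable (Ig : QIdx σ)

/-! ## Part T5: finite SHIFT RANK of the slice functions — the hypothesis of val-lit-p3's `ShiftRank.pencilCount` -/

section ShiftDecomp


/-- `lam_add` — technical lemma of the R7b dilated free-lift toolkit (val-idea-8 g3). [folklore] -/
theorem lam_add (β w : σ → ℕ) : lam Ig (β + w) = lam Ig β + lam Ig w := by
  unfold lam
  simp only [Pi.add_apply, Finset.sum_add_distrib]

/-- Binomial coefficients of the additive form `λ` have shift rank `d + 1` (Vandermonde). [folklore] -/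
theorem hsd_choose (e d b₀ : ℕ) (hd : d ≤ b₀) :
    R6b.HSD (Fin (b₀ + 1)) (fun ν : σ → ℕ => (((lam Ig ν + e).choose d : ℕ) : ℂ)) := by
  refine ⟨fun β p => if (p : ℕ) ≤ d then (((lam Ig β + e).choose p : ℕ) : ℂ) else 0,
    fun p w => (((lam Ig w).choose (d - p) : ℕ) : ℂ), fun β w => ?_⟩
  have hnat : (lam Ig β + e + lam Ig w).choose d =
      ∑ p ∈ Finset.range (d + 1), (lam Ig β + e).choose p * (lam Ig w).choose (d - p) := by
    have h := Finset.Nat.sum_antidiagonal_eq_sum_range_succ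
      (fun p q => (lam Ig β + e).choose p * (lam Ig w).choose q) d
    rw [Nat.succ_eq_add_one] at h
    rw [← h, Nat.add_choose_eq]
  simp only
  rw [lam_add, show lam Ig β + lam Ig w + e = lam Ig β + e + lam Ig w by ring, hnat]
  push_cast
  rw [Fin.sum_univ_eq_sum_range (fun p => (if p ≤ d then (((lam Ig β + e).choose p : ℕ) : ℂ) else 0) *
      (((lam Ig w).choose (d - p) : ℕ) : ℂ)) (b₀ + 1)]
  simp_rw [ite_mul, zero_mul]
  rw [← Finset.sum_filter]
  congr 1
  ext p
  simp only [Finset.mem_range, Finset.mem_filter]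
  omega

/-- `restProd_add` — technical lemma of the R7b dilated free-lift toolkit (val-idea-8 g3). [folklore] -/
theorem restProd_add (t : σ → ℂ) (β w : σ → ℕ) : restProd Ig t (β + w) = restProd Ig t β * restProd Ig t w := by
  unfold restProd
  rw [← Finset.prod_mul_distrib]
  exact Finset.prod_congr rfl fun j _ => by rw [Pi.add_apply, pow_add]

/-- `ind_add` — technical lemma of the R7b dilated free-lift toolkit (val-idea-8 g3). [folklore] -/
theorem ind_add (β w : σ → ℕ) : ind Ig (β + w) = ind Ig β * ind Ig w := by
  unfold ind
  simp only [Pi.add_apply]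
  by_cases hβ : β Ig.a = 0 ∧ β Ig.b = 0 ∧ β Ig.c = 0 <;> by_cases hw : w Ig.a = 0 ∧ w Ig.b = 0 ∧ w Ig.c = 0
  · rw [if_pos hβ, if_pos hw, if_pos ⟨by omega, by omega, by omega⟩, mul_one]
  · rw [if_pos hβ, if_neg hw, if_neg (fun h => hw ⟨by omega, by omega, by omega⟩), mul_zero]
  · rw [if_neg hβ, if_neg (fun h => hβ ⟨by omega, by omega, by omega⟩), zero_mul]
  · rw [if_neg hβ, if_neg (fun h => hβ ⟨by omega, by omega, by omega⟩), zero_mul]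

variable {m : ℕ}

/-- `corr_hsd` — technical lemma of the R7b dilated free-lift toolkit (val-idea-8 g3). [folklore] -/
theorem corr_hsd (c d : Fin m → σ → ℂ) (b₁ b₂ : ℕ) : R6b.HSD Unit (corr Ig c d b₁ b₂) := by
  refine ⟨fun β _ => corr Ig c d b₁ b₂ β, fun _ w => if (∀ j, w j = 0) then 1 else 0, fun β w => ?_⟩
  rw [Fintype.sum_unique]
  dsimp only
  unfold corr
  by_cases hβ : ∀ j, β j = 0
  · by_cases hw : ∀ j, w j = 0
    · rw [if_pos hw, if_pos hβ, mul_one, if_pos]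
      intro j; rw [Pi.add_apply, hβ j, hw j]
    · rw [if_neg hw, mul_zero, if_neg]
      intro h; apply hw; intro j; have := h j; rw [Pi.add_apply] at this; omega
  · rw [if_neg hβ, zero_mul, if_neg]
    intro h; apply hβ; intro j; have := h j; rw [Pi.add_apply] at this; omega

/-- Each `(j, k)` term has shift rank `≤ b₁ + b₂ + 1`. [folklore] -/
theorem mainTerm_hsd (c d : Fin m → σ → ℂ) (b₁ b₂ : ℕ) (j : Fin m ⊕ Fin m) (k : ℕ) :
    R6b.HSD (Fin (b₁ + b₂ + 1)) (mainTerm Ig c d b₁ b₂ j k) := by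
  by_cases hk : Adm Ig b₁ b₂ k
  · have h1 := hsd_choose Ig (Bk Ig b₁ b₂ k - 1) (Bk Ig b₁ b₂ k) (b₁ + b₂) (Bk_le Ig hk)
    have h2 := R6b.HSD.homMul (restProd_add Ig (tab c d j)) h1
    have h3 := h2.constMul (mainConst Ig c d b₁ b₂ j k)
    unfold mainTerm
    exact h3
  · refine ⟨fun _ _ => 0, fun _ _ => 0, fun β w => ?_⟩
    unfold mainTerm
    rw [mainConst_eq_zero Ig c d hk j, zero_mul]
    simp

/-- **Finite shift rank of the slice functions.** [folklore] -/
theorem Fsl_hsd (c d : Fin m → σ → ℂ) (b₁ b₂ : ℕ) : R6b.HSD (R7a.SIdx m b₁ b₂) (Fsl Ig c d b₁ b₂) := by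
  have hmain : R6b.HSD ((Fin m ⊕ Fin m) × (Fin (b₁ + b₂ + 1) × Fin (b₁ + b₂ + 1)))
      (fun ν => ∑ j : Fin m ⊕ Fin m, ∑ k : Fin (b₁ + b₂ + 1), mainTerm Ig c d b₁ b₂ j k ν) :=
    R6b.HSD.sum _ fun j => R6b.HSD.sum (fun (k : Fin (b₁ + b₂ + 1)) ν => mainTerm Ig c d b₁ b₂ j k ν)
      fun k => mainTerm_hsd Ig c d b₁ b₂ j k
  have h := (R6b.HSD.homMul (ind_add Ig) hmain).add (corr_hsd Ig c d b₁ b₂)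
  unfold Fsl
  exact h

/-- The shift decomposition, unpacked. [folklore] -/
theorem Fsl_shift (c d : Fin m → σ → ℂ) (b₁ b₂ : ℕ) :
    ∃ (col : (σ → ℕ) → R7a.SIdx m b₁ b₂ → ℂ) (ch : R7a.SIdx m b₁ b₂ → (σ → ℕ) → ℂ),
      ∀ β w : σ → ℕ, Fsl Ig c d b₁ b₂ (β + w) = ∑ i, col β i * ch i w :=
  Fsl_hsd Ig c d b₁ b₂

end ShiftDecomp

/-! ## Part T7: the planar instance — relation data `pα = qβ + rγ`, the lift of the chain, the `p`-DILATED letter push-forward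
`enumP`, injectivity on the lifted support from rank-one coincidences, lifted visible points (over `p·l`), letter weights -/

section FreePlanar
open Summit.ValiantsHypothesis.ValiantsHypothesis.Theorems.NewtonUnitEquations.TwoProducts.FormalLogLinearisation
open Summit.ValiantsHypothesis.ValiantsHypothesis.Theorems.NewtonUnitEquations.TwoProducts.PlanarCell

variable {m : ℕ}
variable (u v : Fin m → MvPolynomial (Fin 2) ℂ)

/-- **Planar three-term relation data with coefficients**: distinct tail letters `α, β, γ` with `p α = q β + r γ`,
`p, q ≥ 1`, `r ≥ 0` (`r = 0`: the two-letter torsion relation `p α = q β` with an idle third tail letter `γ`). [folklore] -/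
structure RelData where
  /-- the letter `α` -/
  α : Expo
  /-- the letter `β` -/
  β : Expo
  /-- the letter `γ` -/
  γ : Expo
  /-- the coefficient of `β` -/
  q : ℕ
  /-- the coefficient of `γ` -/
  r : ℕ
  /-- the coefficient of `α` -/
  p : ℕ
  hq : 1 ≤ q
  hp : 1 ≤ p
  hα : α ∈ tailSupport u v
  hβ : β ∈ tailSupport u v
  hγ : γ ∈ tailSupport u v
  hab : α ≠ β
  hac : α ≠ γ
  hbc : β ≠ γ
  hrel : p • α = q • β + r • γ

variable {u v}
variable (Dg : RelData u v)

/-- The indices and coefficients of the relation letters. [folklore] -/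
def RelData.idx : QIdx (Fin (sE u v)) where
  a := idxOf u v Dg.α Dg.hα
  b := idxOf u v Dg.β Dg.hβ
  c := idxOf u v Dg.γ Dg.hγ
  q := Dg.q
  r := Dg.r
  p := Dg.p
  hq := Dg.hq
  hp := Dg.hp
  hab h := Dg.hab (by have := congrArg (enum u v) h; rwa [enum_idxOf, enum_idxOf] at this)
  hac h := Dg.hac (by have := congrArg (enum u v) h; rwa [enum_idxOf, enum_idxOf] at this)
  hbc h := Dg.hbc (by have := congrArg (enum u v) h; rwa [enum_idxOf, enum_idxOf] at this)

/-- `RelData.enum_a` — technical lemma of the R7b dilated free-lift toolkit (val-idea-8 g3). [folklore] -/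
theorem RelData.enum_a : enum u v Dg.idx.a = Dg.α := enum_idxOf u v _ _
/-- `RelData.enum_b` — technical lemma of the R7b dilated free-lift toolkit (val-idea-8 g3). [folklore] -/
theorem RelData.enum_b : enum u v Dg.idx.b = Dg.β := enum_idxOf u v _ _
/-- `RelData.enum_c` — technical lemma of the R7b dilated free-lift toolkit (val-idea-8 g3). [folklore] -/
theorem RelData.enum_c : enum u v Dg.idx.c = Dg.γ := enum_idxOf u v _ _
/-- `RelData.idx_q` — technical lemma of the R7b dilated free-lift toolkit (val-idea-8 g3). [folklore] -/
theorem RelData.idx_q : Dg.idx.q = Dg.q := rfl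
/-- `RelData.idx_r` — technical lemma of the R7b dilated free-lift toolkit (val-idea-8 g3). [folklore] -/
theorem RelData.idx_r : Dg.idx.r = Dg.r := rfl
/-- `RelData.idx_p` — technical lemma of the R7b dilated free-lift toolkit (val-idea-8 g3). [folklore] -/
theorem RelData.idx_p : Dg.idx.p = Dg.p := rfl

/-- The exponent dilation `e ↦ p e` as a monomial substitution on the plane (`X_k ↦ X_k^p`). [folklore] -/
def dilE (p : ℕ) (k : Fin 2) : Expo := Finsupp.single k p

/-- `piT_dilE` — technical lemma of the R7b dilated free-lift toolkit (val-idea-8 g3). [folklore] -/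
theorem piT_dilE (p : ℕ) (e : Expo) : piT (dilE p) e = p • e := by
  ext j
  rw [piT_apply]
  unfold dilE
  rw [Finset.sum_eq_single j (fun k _ hk => by rw [Finsupp.single_apply, if_neg hk, mul_zero])
    (fun h => absurd (Finset.mem_univ j) h)]
  rw [Finsupp.single_eq_same, Finsupp.smul_apply, smul_eq_mul, Nat.mul_comm]

/-- `piE_dilE` — technical lemma of the R7b dilated free-lift toolkit (val-idea-8 g3). [folklore] -/
theorem piE_dilE (p : ℕ) (e : Expo) : piE (dilE p) e = p • e := by
  rw [piE_eq_piT, piT_dilE]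
/-- The `p`-DILATED planar push-forward of the new letters: `Y_b ↦ β`, `Y_c ↦ γ`, `Y_i ↦ p · enum i` otherwise. [folklore] -/
def RelData.enumP (i : Fin (sE u v)) : Expo :=
  if i = Dg.idx.b then Dg.β else if i = Dg.idx.c then Dg.γ else Dg.p • enum u v i

/-- `RelData.enumP_b` — technical lemma of the R7b dilated free-lift toolkit (val-idea-8 g3). [folklore] -/
theorem RelData.enumP_b : Dg.enumP Dg.idx.b = Dg.β := by
  unfold RelData.enumP; rw [if_pos rfl]

/-- `RelData.enumP_c` — technical lemma of the R7b dilated free-lift toolkit (val-idea-8 g3). [folklore] -/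
theorem RelData.enumP_c : Dg.enumP Dg.idx.c = Dg.γ := by
  unfold RelData.enumP; rw [if_neg (fun h => Dg.idx.hbc h.symm), if_pos rfl]

/-- `RelData.enumP_other` — technical lemma of the R7b dilated free-lift toolkit (val-idea-8 g3). [folklore] -/
theorem RelData.enumP_other (i : Fin (sE u v)) (hb : i ≠ Dg.idx.b) (hc : i ≠ Dg.idx.c) : Dg.enumP i = Dg.p • enum u v i := by
  unfold RelData.enumP; rw [if_neg hb, if_neg hc]

/-- The dilated push-forward of a substituted letter is `p` times the letter: `π_{enumP} (frM i) = p · enum i`. [folklore] -/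
theorem RelData.piE_enumP_frM (i : Fin (sE u v)) : piE Dg.enumP (frM Dg.idx i) = Dg.p • enum u v i := by
  by_cases hia : i = Dg.idx.a
  · subst hia
    rw [frM_a, piE_eq_piT, piT_add, piT_single, piT_single, Dg.enumP_b, Dg.enumP_c, Dg.enum_a, Dg.hrel, Dg.idx_q, Dg.idx_r]
  by_cases hib : i = Dg.idx.b
  · subst hib
    rw [frM_b, piE_eq_piT, piT_single, Dg.enumP_b, Dg.enum_b, Dg.idx_p]
  by_cases hic : i = Dg.idx.c
  · subst hic
    rw [frM_c, piE_eq_piT, piT_single, Dg.enumP_c, Dg.enum_c, Dg.idx_p]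
  · rw [frM_other Dg.idx i hia hib hic, piE_eq_piT, piT_single, one_smul, Dg.enumP_other i hib hic]

/-- `RelData.comp_eq` — technical lemma of the R7b dilated free-lift toolkit (val-idea-8 g3). [folklore] -/
theorem RelData.comp_eq : (fun i => piT Dg.enumP (frM Dg.idx i)) = fun i => piT (dilE Dg.p) (enum u v i) := by
  funext i
  rw [← piE_eq_piT, Dg.piE_enumP_frM, piT_dilE]

/-- On exponents: dilated push-forward ∘ substitution = `p` · letter push-forward. [folklore] -/
theorem RelData.piE_enumP_piT (L : Fin (sE u v) →₀ ℕ) : piE Dg.enumP (piT (frM Dg.idx) L) = Dg.p • piE (enum u v) L := by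
  rw [piE_eq_piT, piE_eq_piT, piT_piT, Dg.comp_eq, ← piT_piT, piT_dilE]

/-- On polynomials: dilated push-forward ∘ substitution = dilation ∘ letter push-forward. [folklore] -/
theorem RelData.phi_enumP_phiT (H : MvPolynomial (Fin (sE u v)) ℂ) :
    phi Dg.enumP (phiT (frM Dg.idx) H) = phi (dilE Dg.p) (phi (enum u v) H) := by
  rw [phi_eq_phiT, phi_eq_phiT, phi_eq_phiT, phiT_phiT, Dg.comp_eq, ← phiT_phiT]

/-- The lift of the chain difference. [folklore] -/
def RelData.GT : MvPolynomial (Fin (sE u v)) ℂ := phiT (frM Dg.idx) (liftG (cU u v) (cV u v))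

/-- Its dilated push-forward is the `p`-dilation of the planar difference of products. [folklore] -/
theorem RelData.phi_GT : phi Dg.enumP Dg.GT = phi (dilE Dg.p) (tailDiff u v) := by
  unfold RelData.GT
  rw [Dg.phi_enumP_phiT, phi_liftG]

/-- `RelData.exists_of_mem_support_GT` — technical lemma of the R7b dilated free-lift toolkit (val-idea-8 g3). [folklore] -/
theorem RelData.exists_of_mem_support_GT (x : Fin (sE u v) →₀ ℕ) (hx : x ∈ Dg.GT.support) :
    ∃ L ∈ (liftG (cU u v) (cV u v)).support, piT (frM Dg.idx) L = x :=
  exists_of_mem_support_phiT (frM Dg.idx) _ x hx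

/-- `RelData.apply_a_of_mem_support_GT` — technical lemma of the R7b dilated free-lift toolkit (val-idea-8 g3). [folklore] -/
theorem RelData.apply_a_of_mem_support_GT (x : Fin (sE u v) →₀ ℕ) (hx : x ∈ Dg.GT.support) : x Dg.idx.a = 0 := by
  obtain ⟨L, -, rfl⟩ := Dg.exists_of_mem_support_GT x hx
  exact piT_frM_a Dg.idx L

/-- **Injectivity from rank-one coincidences** (shape `pα = qβ + rγ`), for the dilated push-forward. [folklore] -/
theorem RelData.injOn_of_rankOne (hu : ∀ j, coeff 0 (u j) = 0) (hv : ∀ j, coeff 0 (v j) = 0)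
    (hR : RankOneCoincidences (fun j => (u j).support ∪ (v j).support)
      (Finsupp.single Dg.β Dg.q + Finsupp.single Dg.γ Dg.r) (Finsupp.single Dg.α Dg.p)) :
    Set.InjOn (piE Dg.enumP) ↑Dg.GT.support := by
  classical
  set A : Fin m → Finset Expo := fun j => (u j).support ∪ (v j).support with hA
  have hcU : ∀ j i, cU u v j i ≠ 0 → enum u v i ∈ A j := fun j i h =>
    Finset.mem_union_left _ (mem_support_iff.mpr h)
  have hcV : ∀ j i, cV u v j i ≠ 0 → enum u v i ∈ A j := fun j i h =>
    Finset.mem_union_right _ (mem_support_iff.mpr h)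
  have key : ∀ κ ∈ (liftG (cU u v) (cV u v)).support,
      ∃ a ∈ tuples A, ∑ j, a j = piE (enum u v) κ ∧ msetT a = Finsupp.mapDomain (enum u v) κ := by
    intro κ hκ
    unfold liftG at hκ
    rcases Finset.mem_union.1 (support_sub _ _ _ hκ) with h | h
    · exact tuple_of_mem_support_prod u v hu hv A (cU u v) hcU κ h
    · exact tuple_of_mem_support_prod u v hu hv A (cV u v) hcV κ h
  set ρp : Fin (sE u v) →₀ ℕ := Finsupp.single Dg.idx.b Dg.q + Finsupp.single Dg.idx.c Dg.r with hρp
  set ρm : Fin (sE u v) →₀ ℕ := Finsupp.single Dg.idx.a Dg.p with hρm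
  have hmp : Finsupp.mapDomain (enum u v) ρp = Finsupp.single Dg.β Dg.q + Finsupp.single Dg.γ Dg.r := by
    rw [hρp, Finsupp.mapDomain_add, Finsupp.mapDomain_single, Finsupp.mapDomain_single, Dg.enum_b, Dg.enum_c]
  have hmm : Finsupp.mapDomain (enum u v) ρm = Finsupp.single Dg.α Dg.p := by
    rw [hρm, Finsupp.mapDomain_single, Dg.enum_a]
  have hπρ : piT (frM Dg.idx) ρp = piT (frM Dg.idx) ρm := by
    rw [hρp, hρm, piT_add, piT_single, piT_single, piT_single, frM_b, frM_c, frM_a, Dg.idx_q, Dg.idx_r, Dg.idx_p,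
      smul_add, Finsupp.smul_single, Finsupp.smul_single, Finsupp.smul_single, Finsupp.smul_single]
    simp only [smul_eq_mul]
    rw [Nat.mul_comm Dg.q Dg.p, Nat.mul_comm Dg.r Dg.p]
  have hmapk : ∀ (k : ℕ) (L ρ : Fin (sE u v) →₀ ℕ),
      Finsupp.mapDomain (enum u v) (L + k • ρ) = Finsupp.mapDomain (enum u v) L + k • Finsupp.mapDomain (enum u v) ρ := by
    intro k L ρ
    rw [Finsupp.mapDomain_add]
    congr 1
    exact map_nsmul (Finsupp.mapDomain.addMonoidHom (enum u v)) k ρ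
  have cancel : ∀ (k : ℕ) (L L' : Fin (sE u v) →₀ ℕ), L + k • ρp = L' + k • ρm →
      piT (frM Dg.idx) L = piT (frM Dg.idx) L' := by
    intro k L L' h
    have := congrArg (piT (frM Dg.idx)) h
    rw [piT_add, piT_add, piT_nsmul, piT_nsmul, hπρ] at this
    exact add_right_cancel this
  intro x hx x' hx' hπ
  obtain ⟨L, hL, rfl⟩ := Dg.exists_of_mem_support_GT x hx
  obtain ⟨L', hL', rfl⟩ := Dg.exists_of_mem_support_GT x' hx'
  rw [Dg.piE_enumP_piT, Dg.piE_enumP_piT] at hπ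
  replace hπ := PlanarCell.eq_of_nsmul_eq Dg.hp hπ
  obtain ⟨a, ha, haS, haM⟩ := key L hL
  obtain ⟨b, hb, hbS, hbM⟩ := key L' hL'
  obtain ⟨k, hk⟩ := hR a ha b hb (by rw [haS, hbS]; exact hπ)
  rw [haM, hbM, ← hmp, ← hmm, ← hmapk, ← hmapk, ← hmapk, ← hmapk] at hk
  rcases hk with hk | hk
  · exact cancel k L L' (Finsupp.mapDomain_injective (enum_injective u v) hk)
  · exact (cancel k L' L (Finsupp.mapDomain_injective (enum_injective u v) hk)).symm

/-- Visible points lift (over `p · l`) to strict `ξ`-maxima of the lifted support (under injectivity). [folklore] -/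
theorem RelData.lifted_of_visible (hinj : Set.InjOn (piE Dg.enumP) ↑Dg.GT.support) (ξ : Fin 2 → ℝ) (l : Expo)
    (htop : IsStrictTop ξ ↑(tailDiff u v).support l) :
    ∃ x₀ : Fin (sE u v) →₀ ℕ, x₀ ∈ Dg.GT.support ∧ piE Dg.enumP x₀ = Dg.p • l ∧
      ∀ x ∈ Dg.GT.support, x ≠ x₀ → wt ξ (piE Dg.enumP x) < wt ξ (Dg.p • l) := by
  have hsupp : phi Dg.enumP Dg.GT = phi (dilE Dg.p) (tailDiff u v) := Dg.phi_GT
  have hinjD : Set.InjOn (piE (dilE Dg.p)) ↑(tailDiff u v).support := fun e _ e' _ h => by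
    rw [piE_dilE, piE_dilE] at h; exact PlanarCell.eq_of_nsmul_eq Dg.hp h
  obtain ⟨hl, hlt⟩ := htop
  have hl' : Dg.p • l ∈ (phi Dg.enumP Dg.GT).support := by
    rw [hsupp, mem_support_iff, ← piE_dilE Dg.p l, coeff_phi_of_injOn (dilE Dg.p) _ hinjD l hl]
    exact mem_support_iff.mp hl
  obtain ⟨x₀, hx₀, hπ⟩ := exists_of_mem_support_phi Dg.enumP _ _ hl'
  refine ⟨x₀, hx₀, hπ, fun x hx hne => ?_⟩
  have hmem : piE Dg.enumP x ∈ (phi (dilE Dg.p) (tailDiff u v)).support := by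
    rw [← hsupp, mem_support_iff, coeff_phi_of_injOn Dg.enumP _ hinj x hx]
    exact mem_support_iff.mp hx
  obtain ⟨e, he, hπe⟩ := exists_of_mem_support_phi (dilE Dg.p) _ _ hmem
  rw [piE_dilE] at hπe
  have hne' : e ≠ l := by
    intro h; apply hne; apply hinj hx hx₀; rw [← hπe, h, hπ]
  have h1 := hlt e he hne'
  rw [← hπe, wt_nsmul, wt_nsmul]
  have hp : (0 : ℝ) < Dg.p := by exact_mod_cast Dg.hp
  exact mul_lt_mul_of_pos_left h1 hp


end FreePlanar

end R7b
end Summit.ValiantsHypothesis.ValiantsHypothesis.Theorems.NewtonUnitEquations.TwoProducts.PermutationType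

end
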